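import Literature.Algebra.EuclideanLattices.SmoothingParameterBounds
import HarnessLib

/-!
# MR07 Lemma 3.2 with its true constant: `η_{2⁻ⁿ}(L) ≤ (4/5)√n/λ₁(L*)` in dimension `n ≥ 3`

Topic `Algebra/EuclideanLattices` (family `pqc`). `SmoothingParameterBounds.lean` proves MR07 Lemma 3.2
in the rounded form `η_{2⁻ⁿ}(L) ≤ √n/λ₁(L*)` (Banaszczyk's tail bound with the constant of the ball of
radius `σ√n`, `C = √(2πe)e^{−π} < 1/4`). Banaszczyk's bound holds for every radius `a σ √n`, `a ≥ 1/√(2π)`,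
with constant `C(a) = a√(2πe) e^{−πa²}` (`gaussianMass_diff_ball_le_pow_mul_holds`), and `C(4/5) < 12/25`
still gives `C(a)ⁿ(1 + 2⁻ⁿ) ≤ 2⁻ⁿ` from dimension `3` on. This file records the resulting sharper form,
which the machine-level MR07 Thm. 5.23 uses to keep a constant-factor window between the verifier's two
thresholds under the printed modulus condition `q ≥ 4√m n^{1.5} β` (there the parameter `s = 2√n/(γd)` must
dominate `2η_{2⁻ⁿ}(L(B)*)` with room for the rounding of the short dual set and of the sampler's width):

* `banaszczykConst_four_fifths_le` — `(4/5)√(2πe) e^{−π(4/5)²} ≤ 12/25`;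
* `gaussianMass_dual_le_two_pow_neg_of_lt_sharp` — `n ≥ 3`, `s > (4/5)√n/λ₁(L*)` ⇒ `ρ_{1/s}(L* ∖ {0}) ≤ 2⁻ⁿ`;
* **`smoothingParameter_two_inv_pow_le_sharp`** — `n ≥ 3` ⇒ `η_{2⁻ⁿ}(L) ≤ (4/5)√n/λ₁(L*)`.

All proved, no definitions, no named fact.

## References

* D. Micciancio, O. Regev, *Worst-case to average-case reductions based on Gaussian measures*,
  SIAM J. Comput. 37 (2007) 267–302; authors' version, Lemma 3.2 and its proof (pp. 10–11).
* W. Banaszczyk, *New bounds in some transference theorems in the geometry of numbers*, Math. Ann. 296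
  (1993), Lemma 1.5(i).
-/

noncomputable section

open MeasureTheory Module Metric Filter
open scoped Real ENNReal InnerProductSpace Topology

namespace Literature.Algebra.EuclideanLattices

/-- The Banaszczyk constant at radius factor `4/5`: `(4/5)√(2πe) e^{−π(4/5)²} ≤ 12/25`
(`√(2πe) ≤ 21/5`, `π(4/5)² ≥ 2`, `e² ≥ 7`). [cite: MicciancioRegev2007, Lemma 3.2 (proof, p. 11: the constant `C`)] -/
theorem banaszczykConst_four_fifths_le :
    (4 / 5 : ℝ) * Real.sqrt (2 * π * Real.exp 1) * Real.exp (-π * (4 / 5 : ℝ) ^ 2) ≤ 12 / 25 := by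
  have hπ := Real.pi_lt_d2
  have hπ' := Real.pi_gt_d2
  have he := Real.exp_one_lt_d9
  have he' := Real.exp_one_gt_d9
  have h1 : Real.sqrt (2 * π * Real.exp 1) ≤ 21 / 5 := by
    rw [Real.sqrt_le_left (by norm_num)]
    nlinarith
  have h2 : Real.exp (-π * (4 / 5 : ℝ) ^ 2) ≤ 1 / 7 := by
    have h3 : Real.exp (-π * (4 / 5 : ℝ) ^ 2) ≤ Real.exp (-2) := Real.exp_le_exp.2 (by nlinarith)
    refine h3.trans ?_
    rw [Real.exp_neg, inv_eq_one_div, div_le_div_iff_of_pos_left one_pos (Real.exp_pos _) (by norm_num)]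
    rw [show (2 : ℝ) = 1 + 1 by norm_num, Real.exp_add]
    nlinarith [Real.exp_pos 1]
  calc (4 / 5 : ℝ) * Real.sqrt (2 * π * Real.exp 1) * Real.exp (-π * (4 / 5 : ℝ) ^ 2)
      ≤ (4 / 5 : ℝ) * (21 / 5) * (1 / 7) := by gcongr
    _ = 12 / 25 := by norm_num

section FullRank

variable {E : Type*} [NormedAddCommGroup E] [InnerProductSpace ℝ E] (L : Submodule ℤ E)
  [FiniteDimensional ℝ E] [DiscreteTopology L] [IsZLattice ℝ L]

/-- **MR07 Lemma 3.2, main estimate with the radius factor `4/5`**: in dimension `n ≥ 3`, for every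
`s > (4/5)√n/λ₁(L*)`, `ρ_{1/s}(L* ∖ {0}) ≤ 2⁻ⁿ` (Banaszczyk's tail bound at radius `(4/5)σ√n`:
`ρ ≤ C(4/5)ⁿ(1 + ρ)` with `C(4/5) ≤ 12/25`, and `(24/25)ⁿ + (12/25)ⁿ ≤ 1` for `n ≥ 3`).
[cite: MicciancioRegev2007, Lemma 3.2 (proof, p. 11)] -/
theorem gaussianMass_dual_le_two_pow_neg_of_lt_sharp [Nontrivial E] (hn3 : 3 ≤ finrank ℝ E) {s : ℝ}
    (hs : 4 / 5 * Real.sqrt (finrank ℝ E) / minNorm (dualLattice L) < s) :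
    gaussianMass (1 / s) 0 ((dualLattice L : Set E) \ {0}) ≤ ENNReal.ofReal ((2⁻¹ : ℝ) ^ finrank ℝ E) := by
  set n : ℕ := finrank ℝ E with hn
  have hn0 : n ≠ 0 := by omega
  set Λ : Submodule ℤ E := dualLattice L with hΛ
  have hlam : 0 < minNorm Λ := minNorm_pos_of_ne_bot Λ (dualLattice_ne_bot L)
  have hsqrt : 0 < Real.sqrt n := Real.sqrt_pos.2 (by exact_mod_cast Nat.pos_of_ne_zero hn0)
  have hs0 : 0 < s := lt_trans (div_pos (by positivity) hlam) hs
  set σ : ℝ := 1 / s with hσdef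
  have hσ : 0 < σ := one_div_pos.2 hs0
  have hσn : 4 / 5 * σ * Real.sqrt n < minNorm Λ := by
    rw [div_lt_iff₀ hlam] at hs
    rw [hσdef, show 4 / 5 * (1 / s) * Real.sqrt n = (4 / 5 * Real.sqrt n) / s by ring, div_lt_iff₀ hs0]
    linarith
  -- every nonzero dual vector lies outside the ball of radius `(4/5) σ √n`
  have hsub : (Λ : Set E) \ {0} ⊆ (Λ : Set E) \ ball (0 : E) (4 / 5 * σ * Real.sqrt n) := by
    rintro w ⟨hw, hw0⟩
    refine ⟨hw, ?_⟩
    rw [Metric.mem_ball, dist_zero_right, not_lt]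
    exact hσn.le.trans (minNorm_le_norm_of_mem_of_ne_zero Λ hw hw0)
  have h1 : 1 / Real.sqrt (2 * Real.pi) ≤ 4 / 5 := by
    rw [div_le_iff₀ (Real.sqrt_pos.2 (by positivity))]
    have : (5 / 4 : ℝ) ≤ Real.sqrt (2 * Real.pi) := Real.le_sqrt_of_sq_le (by nlinarith [Real.pi_gt_three])
    linarith
  have hB := gaussianMass_diff_ball_le_pow_mul_holds Λ hσ h1
  set K : ℝ := (4 / 5 * Real.sqrt (2 * Real.pi * Real.exp 1) * Real.exp (-Real.pi * (4 / 5 : ℝ) ^ 2)) ^ n with hK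
  set m : ℝ≥0∞ := gaussianMass σ 0 ((Λ : Set E) \ {0}) with hm
  have hmtop : m ≠ ∞ :=
    ne_top_of_le_ne_top (gaussianMass_lattice_ne_top Λ hσ.ne' 0) (gaussianMass_mono _ _ Set.sdiff_subset)
  -- `m ≤ K (1 + m)` in `ℝ≥0∞`
  have hmle : m ≤ ENNReal.ofReal K * (1 + m) := by
    calc m ≤ gaussianMass σ 0 ((Λ : Set E) \ ball (0 : E) (4 / 5 * σ * Real.sqrt n)) := gaussianMass_mono _ _ hsub
      _ ≤ ENNReal.ofReal K * gaussianMass σ 0 (Λ : Set E) := hB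
      _ = ENNReal.ofReal K * (1 + m) := by
          rw [gaussianMass_eq_add_sdiff_zero Λ σ 0, gaussianFunction_zero, ENNReal.ofReal_one]
  -- the same in `ℝ`
  set x : ℝ := (2⁻¹ : ℝ) ^ n with hx
  have hx0 : 0 < x := by positivity
  have hK0 : 0 ≤ K := by positivity
  -- `K ≤ (12/25)ⁿ = (24/25)ⁿ x`
  have hKz : K ≤ (24 / 25 : ℝ) ^ n * x := by
    calc K ≤ ((12 / 25 : ℝ)) ^ n := pow_le_pow_left₀ (by positivity) banaszczykConst_four_fifths_le n
      _ = (24 / 25 : ℝ) ^ n * x := by rw [hx, ← mul_pow]; norm_num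
  -- `(24/25)ⁿ (1 + x) ≤ 1` for `n ≥ 3`
  have hy : (24 / 25 : ℝ) ^ n ≤ (24 / 25 : ℝ) ^ 3 := pow_le_pow_of_le_one (by norm_num) (by norm_num) hn3
  have hx3 : x ≤ (2⁻¹ : ℝ) ^ 3 := pow_le_pow_of_le_one (by norm_num) (by norm_num) hn3
  have hyx : (24 / 25 : ℝ) ^ n * (1 + x) ≤ 1 := by
    calc (24 / 25 : ℝ) ^ n * (1 + x) ≤ (24 / 25 : ℝ) ^ 3 * (1 + (2⁻¹ : ℝ) ^ 3) := by gcongr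
      _ ≤ 1 := by norm_num
  have hKx : K * (1 + x) ≤ x := by
    calc K * (1 + x) ≤ (24 / 25 : ℝ) ^ n * x * (1 + x) := by gcongr
      _ = x * ((24 / 25 : ℝ) ^ n * (1 + x)) := by ring
      _ ≤ x * 1 := by gcongr
      _ = x := mul_one x
  have hreal : m.toReal ≤ K * (1 + m.toReal) := by
    have := ENNReal.toReal_mono (ENNReal.mul_ne_top ENNReal.ofReal_ne_top (by simpa using hmtop)) hmle
    rwa [ENNReal.toReal_mul, ENNReal.toReal_ofReal hK0, ENNReal.toReal_add ENNReal.one_ne_top hmtop,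
      ENNReal.toReal_one] at this
  have hm0 : 0 ≤ m.toReal := ENNReal.toReal_nonneg
  have hK1 : K < 1 := by
    have : K * (1 + x) < 1 * (1 + 0) := by nlinarith
    nlinarith
  have hfin : m.toReal ≤ x := by
    -- `m (1 − K) ≤ K ≤ x (1 − K)`
    have h3 : m.toReal * (1 - K) ≤ K := by nlinarith
    have h4 : K ≤ x * (1 - K) := by nlinarith
    exact le_of_mul_le_mul_right (h3.trans h4) (by linarith)
  exact (ENNReal.le_ofReal_iff_toReal_le hmtop hx0.le).2 hfin

/-- **MR07 Lemma 3.2 with its true constant**: in dimension `n ≥ 3`, `η_{2⁻ⁿ}(L) ≤ (4/5)√n/λ₁(L*)`.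
Every `s > (4/5)√n/λ₁(L*)` belongs to the defining set of `η_{2⁻ⁿ}(L)`
(`gaussianMass_dual_le_two_pow_neg_of_lt_sharp`), so the infimum is at most `(4/5)√n/λ₁(L*)`.
[cite: MicciancioRegev2007, Lemma 3.2 (pp. 10–11)] -/
theorem smoothingParameter_two_inv_pow_le_sharp (hn3 : 3 ≤ finrank ℝ E) :
    smoothingParameter L ((2⁻¹ : ℝ) ^ finrank ℝ E) ≤ 4 / 5 * Real.sqrt (finrank ℝ E) / minNorm (dualLattice L) := by
  have : Nontrivial E := Module.nontrivial_of_finrank_pos (R := ℝ) (by omega)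
  refine le_of_forall_gt_imp_ge_of_dense fun s hs ↦ csInf_le (smoothingSet_bddBelow L _) ?_
  have hlam : 0 < minNorm (dualLattice L) := minNorm_pos_of_ne_bot _ (dualLattice_ne_bot L)
  have hsqrt : 0 ≤ Real.sqrt (finrank ℝ E) := Real.sqrt_nonneg _
  exact ⟨lt_of_le_of_lt (div_nonneg (by positivity) hlam.le) hs, gaussianMass_dual_le_two_pow_neg_of_lt_sharp L hn3 hs⟩

/-- **Corollary for the dual**: `n ≥ 3`, `0 < g < λ₁(L)` ⇒ `η_{2⁻ⁿ}(L*) < (4/5)√n/g`.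
[cite: MicciancioRegev2007, Lemma 3.2 with Thm. 5.23 (proof, p. 30: eq. (15))] -/
theorem smoothingParameter_dual_lt_sharp (hn3 : 3 ≤ finrank ℝ E) {g : ℝ} (hg : 0 < g) (hgL : g < minNorm L) :
    smoothingParameter (dualLattice L) ((2⁻¹ : ℝ) ^ finrank ℝ E) < 4 / 5 * Real.sqrt (finrank ℝ E) / g := by
  have h := smoothingParameter_two_inv_pow_le_sharp (dualLattice L) hn3
  rw [dualLattice_dualLattice] at h
  have hpos : 0 < 4 / 5 * Real.sqrt (finrank ℝ E) := by
    have : 0 < Real.sqrt (finrank ℝ E) := Real.sqrt_pos.2 (by exact_mod_cast (show 0 < finrank ℝ E by omega))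
    positivity
  exact h.trans_lt (div_lt_div_of_pos_left hpos hg hgL)

end FullRank

end Literature.Algebra.EuclideanLattices

end
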